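import Mathlib.CategoryTheory.Adjunction.CompositionIso
import Literature.AlgebraicGeometry.Motives.EtalePullback
import HarnessLib

/-!
# Inverse images of étale sheaves, II: `(g f)^* ≅ f^* g^*`, `(𝟙)^* ≅ 𝟭`, and the functoriality
# `(g f)^* = f^* ∘ g^*`, `(𝟙)^* = id` of the pull-back `Hⁿ(Y_et, M) → Hⁿ(X_et, M)`

`EtalePullback.lean` constructed the inverse image `π^* = etalePullback f` (Milne II §3), the
isomorphisms `π^* M_Y ≅ M_X` (`etalePullbackConstantSheafIso`, II Rem. 3.1 (d)) and the pull-backs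
`etaleCohomologyPullback f F n : Hⁿ(Y_et, F) → Hⁿ(X_et, π^* F)`,
`etaleCohomologyMap f M n : Hⁿ(Y_et, M) → Hⁿ(X_et, M)` (III Rem. 1.6 (c)), together with the
uniqueness principle `ext_deltaMorphism` for `δ`-morphisms out of `Hⁿ(Y_et, –)`, and listed as NOT
done the composition/identity isomorphisms and the resulting functoriality. This file supplies them:

* **`(g f)_* = g_* f_*`, `(g f)^* ≅ f^* g^*`** (`etalePushforwardComp`, `etalePullbackComp`; Milne
  II Rem. 3.1 (f): "`π^* π'^*` is adjoint to `π'_* π_*`, which implies `π^* π'^* = (π'π)^*`"): the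
  base-change functors compose up to `U ×_Z X ≅ (U ×_Z Y) ×_Y X` (Mathlib
  `MorphismProperty.Over.pullbackComp`), hence so do the direct images (on the nose up to that
  restriction, `etalePushforwardComp_hom_app_hom_app`), and the inverse images by conjugation
  (Mathlib `Adjunction.leftAdjointCompIso`); likewise **`(𝟙)_* ≅ 𝟭`, `(𝟙)^* ≅ 𝟭`**
  (`etalePushforwardId`, `etalePullbackId`, from `U ×_X X ≅ U`).
* **Coherence with the constant-sheaf isomorphisms** (`etalePullbackComp_inv_app_comp_constantSheafIso`:
  `(gf)^* M_Z ≅ f^* g^* M_Z ≅ f^* M_Y ≅ M_X` is `(gf)^* M_Z ≅ M_X`;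
  `etalePullbackId_hom_app_constantSheaf`: `(𝟙)^* M_X ≅ M_X` is the constant-sheaf isomorphism).
  Proof: a morphism out of a constant sheaf is determined by what it does to *constant sections*
  `M → M_X(T)` over a final object (`constantSheaf_hom_ext`, i.e. `Hom(M_X, G) = Hom(M, G(T))`);
  the constant-sheaf isomorphism sends "constant section, then unit of `π^* ⊣ π_*`" to "constant
  section" (`constantSection_comp_unit_comp_constantSheafIso` — its defining property at the final
  object, transported to every `V ∈ Y_et` by restriction), and the composition/identity
  isomorphisms are pinned down by their unit relations (`unit_app_comp_etalePullbackComp_inv_app`,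
  `unit_app_comp_etalePullbackId_hom_app`, from Mathlib `unit_conjugateEquiv`).
* **Functoriality of the pull-back on cohomology** (Milne III Rem. 1.6 (c): "`Hⁱ(X_E, F)` is a
  contravariant functor on `X_E`"): `etaleCohomologyPullback_etaleCohomologyPullback`
  (`f^*(g^* x) = (gf)^* x` in `Hⁿ(X_et, f^* g^* F)` via `etalePullbackComp`),
  `etaleCohomologyPullback_id`, and for constant coefficients the clean statements
  **`etaleCohomologyMap_comp : (g f)^* = f^* ∘ g^*`** and **`etaleCohomologyMap_id : (𝟙)^* = id`**
  on `Hⁿ(–_et, M)`. Proof: both sides are `δ`-morphisms out of `Hⁿ(Z_et, –)` (resp. `Hⁿ(X_et, –)`)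
  agreeing in degree `0` — `ext_deltaMorphism` — where degree `0` is the coherence above.

## References

* J. S. Milne, *Étale cohomology*, Princeton Univ. Press (reissue 2025; held copy, PDF pages):
  II §3 p. 75, II Rem. 3.1 (d), (f) pp. 76–77, III Rem. 1.6 (c) p. 95. [Milne2025]
* Mathlib: `Adjunction.leftAdjointCompIso`, `Adjunction.leftAdjointIdIso`, `unit_conjugateEquiv`,
  `MorphismProperty.Over.pullbackComp`, `Functor.sheafPushforwardContinuousComp'`/`Id'`.

## Design notes

* Statements about components of morphisms of sheaves are kept in "clean" form (objects written
  `F.obj (G.obj P)`, constant sections through the wrapper `constantSection`, whose source is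
  literally `M`): Mathlib's adjunction lemmas produce `(𝟭 _).obj P` / `(G ⋙ F).obj P`-typed
  morphisms on the full subcategory `Sheaf`, which are not type-correct at instances transparency,
  so the proofs transport such equalities by `Eq.trans`/`congrArg` and explicit `calc` blocks under
  `set_option backward.isDefEq.respectTransparency false` rather than by `simp`.
* What is NOT here: associativity/unit coherences of `etalePullbackComp`/`etalePullbackId` among
  themselves (Mathlib `leftAdjointCompIso_assoc` etc. apply verbatim when needed); the degree-`0`
  description of the pull-back on global sections; pull-backs for non-constant coefficients beyond
  `etaleCohomologyPullback_etaleCohomologyPullback`.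
-/

universe u

open CategoryTheory CategoryTheory.Limits AlgebraicGeometry Opposite

namespace Literature.AlgebraicGeometry.Motives

variable {X Y : Scheme.{u}} (f : X ⟶ Y)

/-! ### Constant sheaves: constant sections, the unit, a hom-ext principle (general sites) -/

section ConstantSheafGeneral

variable {C : Type*} [Category C] (J : GrothendieckTopology C) {D : Type*} [Category D]
  [HasWeakSheafify J D]

/-- The **constant section** map `M → M_J(U)` of the constant sheaf `M_J` with value `M` over an
object `U` of the site: the sheafification map `(const M)(U) = M → M_J(U)`. [folklore] -/
noncomputable def constantSection (M : D) (U : C) :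
    M ⟶ ((constantSheaf J D).obj M).obj.obj (op U) :=
  (toSheafify J ((Functor.const Cᵒᵖ).obj M)).app (op U)

/-- Constant sections restrict to constant sections. [folklore] -/
@[reassoc]
theorem constantSection_comp_map (M : D) {U V : C} (t : V ⟶ U) :
    constantSection J M U ≫ ((constantSheaf J D).obj M).obj.map t.op = constantSection J M V := by
  have := (toSheafify J ((Functor.const Cᵒᵖ).obj M)).naturality t.op
  simp only [Functor.const_obj_map] at this
  exact this.symm.trans (Category.id_comp _)

/-- The unit of `constantSheafAdj` (constant sheaf ⊣ sections over a terminal object `T`) at `M`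
is the constant section map `M → M_J(T)`. [folklore] -/
theorem constantSheafAdj_unit_app {T : C} (hT : IsTerminal T) (M : D) :
    (constantSheafAdj J D hT).unit.app M = constantSection J M T := by
  simp only [constantSheafAdj, Adjunction.comp_unit_app, constantPresheafAdj_unit_app,
    evaluation_obj_map, sheafificationAdjunction_unit_app]
  exact Category.id_comp _

variable {J}

/-- Two morphisms out of a constant sheaf `M_J` agree as soon as they agree on constant sections
over some terminal object (`Hom(M_J, G) ≅ Hom(M, G(T))`). [folklore] -/
theorem constantSheaf_hom_ext {T : C} (hT : IsTerminal T) {M : D} {G : Sheaf J D}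
    (θ θ' : (constantSheaf J D).obj M ⟶ G)
    (h : constantSection J M T ≫ θ.hom.app (op T) = constantSection J M T ≫ θ'.hom.app (op T)) :
    θ = θ' := by
  apply ((constantSheafAdj J D hT).homEquiv _ _).injective
  rw [Adjunction.homEquiv_unit, Adjunction.homEquiv_unit, constantSheafAdj_unit_app]
  exact h

/-- Components of equal morphisms of sheaves are equal. [folklore] -/
theorem Sheaf.congr_hom_app {A : Type*} [Category A] {F G : Sheaf J A} {α β : F ⟶ G}
    (h : α = β) (U : Cᵒᵖ) : α.hom.app U = β.hom.app U := by
  subst h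
  rfl

end ConstantSheafGeneral

/-! ### Composition: `(g ∘ f)^* ≅ f^* ∘ g^*` -/

section Comp

variable {Z : Scheme.{u}} (g : Y ⟶ Z)

/-- Base change along `f ≫ g` is base change along `g` followed by base change along `f`:
`U ×_Z X ≅ (U ×_Z Y) ×_Y X` (Mathlib `MorphismProperty.Over.pullbackComp`). [folklore] -/
noncomputable def etaleBaseChangeComp :
    etaleBaseChange (f ≫ g) ≅ etaleBaseChange g ⋙ etaleBaseChange f :=
  MorphismProperty.Over.pullbackComp f g

/-- **`(g ∘ f)_* = g_* ∘ f_*`** (Milne II Rem. 3.1 (f): "clearly `(π'π)_* = π'_* π_*`"), the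
isomorphism induced by `etaleBaseChangeComp`. [cite: Milne2025, II Remark 3.1 (f)] -/
noncomputable def etalePushforwardComp :
    etalePushforward f Ab.{u} ⋙ etalePushforward g Ab.{u} ≅ etalePushforward (f ≫ g) Ab.{u} :=
  Functor.sheafPushforwardContinuousComp' (etaleBaseChangeComp f g).symm Ab.{u}
    Z.smallEtaleTopology Y.smallEtaleTopology X.smallEtaleTopology

/-- Components of `etalePushforwardComp`: `(g_* f_* G)(W) = G((W ×_Z Y) ×_Y X) → G(W ×_Z X) =
((g f)_* G)(W)` is restriction along `W ×_Z X ≅ (W ×_Z Y) ×_Y X`. [folklore] -/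
theorem etalePushforwardComp_hom_app_hom_app (G : Sheaf X.smallEtaleTopology Ab.{u})
    (W : Z.Etale) :
    ((etalePushforwardComp f g).hom.app G).hom.app (op W) =
      G.obj.map ((etaleBaseChangeComp f g).hom.app W).op := by
  simp [etalePushforwardComp, Functor.sheafPushforwardContinuousComp',
    Functor.sheafPushforwardContinuousComp, Functor.sheafPushforwardContinuousIso]
  exact Category.id_comp _

/-- **`π^* π'^* = (π' π)^*`** (Milne II Rem. 3.1 (f): "`π^* π'^*` is adjoint to `π'_* π_*`, which
implies that `π^* π'^* = (π'π)^*`"): the isomorphism of left adjoints conjugate to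
`etalePushforwardComp` (Mathlib `Adjunction.leftAdjointCompIso`).
[cite: Milne2025, II Remark 3.1 (f)] -/
noncomputable def etalePullbackComp :
    etalePullback g ⋙ etalePullback f ≅ etalePullback (f ≫ g) :=
  Adjunction.leftAdjointCompIso (etalePullbackAdjunction g) (etalePullbackAdjunction f)
    (etalePullbackAdjunction (f ≫ g)) (etalePushforwardComp f g)

/-- `etalePullbackComp` is conjugate to `etalePushforwardComp`. [folklore] -/
theorem conjugateEquiv_etalePullbackComp_inv :
    conjugateEquiv ((etalePullbackAdjunction g).comp (etalePullbackAdjunction f))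
        (etalePullbackAdjunction (f ≫ g)) (etalePullbackComp f g).inv =
      (etalePushforwardComp f g).hom :=
  Adjunction.conjugateEquiv_leftAdjointCompIso_inv _ _ _ _

set_option backward.isDefEq.respectTransparency false in
/-- The unit relation defining `etalePullbackComp`: for a sheaf `P` on `Z_et` and `W ∈ Z_et`,
`η_{gf}(W) ≫ (c⁻¹_P)(W ×_Z X) = η_g(W) ≫ η_f(W ×_Z Y) ≫ (restriction along
W ×_Z X ≅ (W ×_Z Y) ×_Y X)`. [folklore] -/
theorem unit_app_comp_etalePullbackComp_inv_app (P : Sheaf Z.smallEtaleTopology Ab.{u})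
    (W : Z.Etale) :
    ((etalePullbackAdjunction (f ≫ g)).unit.app P).hom.app (op W) ≫
        ((etalePullbackComp f g).inv.app P).hom.app (op ((etaleBaseChange (f ≫ g)).obj W)) =
      ((etalePullbackAdjunction g).unit.app P).hom.app (op W) ≫
        ((etalePullbackAdjunction f).unit.app ((etalePullback g).obj P)).hom.app
          (op ((etaleBaseChange g).obj W)) ≫
        ((etalePullback f).obj ((etalePullback g).obj P)).obj.map
          ((etaleBaseChangeComp f g).hom.app W).op := by
  have h := unit_conjugateEquiv ((etalePullbackAdjunction g).comp
    (etalePullbackAdjunction f)) (etalePullbackAdjunction (f ≫ g)) (etalePullbackComp f g).inv P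
  rw [conjugateEquiv_etalePullbackComp_inv, Adjunction.comp_unit_app] at h
  have h' := Sheaf.congr_hom_app h (op W)
  have key := etalePushforwardComp_hom_app_hom_app f g
    ((etalePullback f).obj ((etalePullback g).obj P)) W
  have e3 : (((etalePullbackAdjunction g).unit.app P).hom.app (op W) ≫
      ((etalePullbackAdjunction f).unit.app ((etalePullback g).obj P)).hom.app
        (op ((etaleBaseChange g).obj W))) ≫
      ((etalePushforwardComp f g).hom.app
        ((etalePullback f).obj ((etalePullback g).obj P))).hom.app (op W) =
      ((etalePullbackAdjunction g).unit.app P).hom.app (op W) ≫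
        ((etalePullbackAdjunction f).unit.app ((etalePullback g).obj P)).hom.app
          (op ((etaleBaseChange g).obj W)) ≫
        ((etalePullback f).obj ((etalePullback g).obj P)).obj.map
          ((etaleBaseChangeComp f g).hom.app W).op := by
    rw [key, Category.assoc]
  exact h'.symm.trans e3

end Comp

/-! ### What the constant-sheaf isomorphism does to constant sections -/

section ConstantSections

variable (M : Ab.{u})

set_option backward.isDefEq.respectTransparency false in
/-- The defining property of `π^* M_Y ≅ M_X` on constant sections over the final object `Y`:
`(constant section) ≫ η(Y) ≫ ι(Y ×_Y X) = (constant section)`. [folklore] -/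
theorem constantSection_comp_unit_comp_constantSheafIso_terminal :
    constantSection Y.smallEtaleTopology M (Scheme.Etale.mk (𝟙 Y)) ≫
      ((etalePullbackAdjunction f).unit.app ((constantSheaf Y.smallEtaleTopology Ab.{u}).obj M)).hom.app (op (Scheme.Etale.mk (𝟙 Y))) ≫
      ((etalePullbackConstantSheafIso f M).hom).hom.app (op ((etaleBaseChange f).obj (Scheme.Etale.mk (𝟙 Y)))) =
    constantSection X.smallEtaleTopology M ((etaleBaseChange f).obj (Scheme.Etale.mk (𝟙 Y))) := by
  have e1 : (constantSheafCompEtalePullbackAdj f).homEquiv _ _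
      ((constantSheafCompEtalePullbackIso f).hom.app M) =
      (constantSheafAdjEtaleBaseChange f).unit.app M :=
    Adjunction.homEquiv_leftAdjointUniq_hom_app _ _ M
  have e2 : (constantSheafCompEtalePullbackAdj f).homEquiv _ _
      ((constantSheafCompEtalePullbackIso f).hom.app M) =
      (constantSheafAdj _ Ab.{u} (isTerminalEtaleMkId Y)).homEquiv _ _
        ((etalePullbackAdjunction f).homEquiv _ _
          ((constantSheafCompEtalePullbackIso f).hom.app M)) := by
    rw [constantSheafCompEtalePullbackAdj, Adjunction.comp_homEquiv]; rfl
  have e3 : (constantSheafAdj _ Ab.{u} (isTerminalEtaleMkId Y)).homEquiv _ _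
        ((etalePullbackAdjunction f).homEquiv _ _
          ((constantSheafCompEtalePullbackIso f).hom.app M)) =
      constantSection Y.smallEtaleTopology M (Scheme.Etale.mk (𝟙 Y)) ≫
      ((etalePullbackAdjunction f).unit.app ((constantSheaf Y.smallEtaleTopology Ab.{u}).obj M)).hom.app (op (Scheme.Etale.mk (𝟙 Y))) ≫
      ((etalePullbackConstantSheafIso f M).hom).hom.app (op ((etaleBaseChange f).obj (Scheme.Etale.mk (𝟙 Y)))) := by
    rw [Adjunction.homEquiv_unit, Adjunction.homEquiv_unit, constantSheafAdj_unit_app]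
    rfl
  have e4 : (constantSheafAdjEtaleBaseChange f).unit.app M =
      constantSection X.smallEtaleTopology M ((etaleBaseChange f).obj (Scheme.Etale.mk (𝟙 Y))) := by
    change (constantSheafAdj _ Ab.{u} (isTerminalEtaleBaseChangeObjMkId f)).unit.app M ≫ 𝟙 _ = _
    rw [Category.comp_id, constantSheafAdj_unit_app]
  exact e3.symm.trans (e2.symm.trans (e1.trans e4))

set_option backward.isDefEq.respectTransparency false in
/-- **What `π^* M_Y ≅ M_X` does to constant sections**: for every `V ∈ Y_et`, the composite
`M → M_Y(V) → (π_* π^* M_Y)(V) = (π^* M_Y)(V ×_Y X) → M_X(V ×_Y X)` of constant section, unit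
of `π^* ⊣ π_*` and `π^* M_Y ≅ M_X` is the constant section (at the final object this is the
defining property of the isomorphism; in general, restrict along `V → Y`). [folklore] -/
@[reassoc]
theorem constantSection_comp_unit_comp_constantSheafIso (V : Y.Etale) :
    constantSection Y.smallEtaleTopology M (V) ≫ ((etalePullbackAdjunction f).unit.app ((constantSheaf Y.smallEtaleTopology Ab.{u}).obj M)).hom.app (op (V)) ≫ ((etalePullbackConstantSheafIso f M).hom).hom.app (op ((etaleBaseChange f).obj V)) =
    constantSection X.smallEtaleTopology M ((etaleBaseChange f).obj V) := by
  let T : Y.Etale := Scheme.Etale.mk (𝟙 Y)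
  let t : V ⟶ T := (isTerminalEtaleMkId Y).from V
  have hκ := constantSection_comp_map Y.smallEtaleTopology M t
  have hη := ((etalePullbackAdjunction f).unit.app ((constantSheaf Y.smallEtaleTopology Ab.{u}).obj M)).hom.naturality t.op
  have hι := ((etalePullbackConstantSheafIso f M).hom).hom.naturality
    ((etaleBaseChange f).map t).op
  have hκ' := constantSection_comp_map X.smallEtaleTopology M ((etaleBaseChange f).map t)
  have h0 := constantSection_comp_unit_comp_constantSheafIso_terminal f M
  calc constantSection Y.smallEtaleTopology M (V) ≫ ((etalePullbackAdjunction f).unit.app ((constantSheaf Y.smallEtaleTopology Ab.{u}).obj M)).hom.app (op (V)) ≫ ((etalePullbackConstantSheafIso f M).hom).hom.app (op ((etaleBaseChange f).obj V))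
      = (constantSection Y.smallEtaleTopology M (T) ≫ ((constantSheaf Y.smallEtaleTopology Ab.{u}).obj M).obj.map t.op) ≫ ((etalePullbackAdjunction f).unit.app ((constantSheaf Y.smallEtaleTopology Ab.{u}).obj M)).hom.app (op (V)) ≫
          ((etalePullbackConstantSheafIso f M).hom).hom.app (op ((etaleBaseChange f).obj V)) := by rw [hκ]
    _ = constantSection Y.smallEtaleTopology M (T) ≫ (((constantSheaf Y.smallEtaleTopology Ab.{u}).obj M).obj.map t.op ≫ ((etalePullbackAdjunction f).unit.app ((constantSheaf Y.smallEtaleTopology Ab.{u}).obj M)).hom.app (op (V))) ≫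
          ((etalePullbackConstantSheafIso f M).hom).hom.app (op ((etaleBaseChange f).obj V)) := by simp only [Category.assoc]
    _ = constantSection Y.smallEtaleTopology M (T) ≫ (((etalePullbackAdjunction f).unit.app ((constantSheaf Y.smallEtaleTopology Ab.{u}).obj M)).hom.app (op (T)) ≫ ((etalePullback f).obj ((constantSheaf Y.smallEtaleTopology Ab.{u}).obj M)).obj.map ((etaleBaseChange f).map t).op) ≫
          ((etalePullbackConstantSheafIso f M).hom).hom.app (op ((etaleBaseChange f).obj V)) :=
        congrArg (fun φ => constantSection Y.smallEtaleTopology M (T) ≫ φ ≫ ((etalePullbackConstantSheafIso f M).hom).hom.app (op ((etaleBaseChange f).obj V))) hη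
    _ = constantSection Y.smallEtaleTopology M (T) ≫ ((etalePullbackAdjunction f).unit.app ((constantSheaf Y.smallEtaleTopology Ab.{u}).obj M)).hom.app (op (T)) ≫ (((etalePullback f).obj ((constantSheaf Y.smallEtaleTopology Ab.{u}).obj M)).obj.map ((etaleBaseChange f).map t).op ≫
          ((etalePullbackConstantSheafIso f M).hom).hom.app (op ((etaleBaseChange f).obj V))) := by simp only [Category.assoc]
    _ = constantSection Y.smallEtaleTopology M (T) ≫ ((etalePullbackAdjunction f).unit.app ((constantSheaf Y.smallEtaleTopology Ab.{u}).obj M)).hom.app (op (T)) ≫ (((etalePullbackConstantSheafIso f M).hom).hom.app (op ((etaleBaseChange f).obj T)) ≫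
          ((constantSheaf X.smallEtaleTopology Ab.{u}).obj M).obj.map ((etaleBaseChange f).map t).op) := by rw [hι]
    _ = (constantSection Y.smallEtaleTopology M (T) ≫ ((etalePullbackAdjunction f).unit.app ((constantSheaf Y.smallEtaleTopology Ab.{u}).obj M)).hom.app (op (T)) ≫ ((etalePullbackConstantSheafIso f M).hom).hom.app (op ((etaleBaseChange f).obj T))) ≫
          ((constantSheaf X.smallEtaleTopology Ab.{u}).obj M).obj.map ((etaleBaseChange f).map t).op := by simp only [Category.assoc]
    _ = constantSection X.smallEtaleTopology M ((etaleBaseChange f).obj T) ≫ ((constantSheaf X.smallEtaleTopology Ab.{u}).obj M).obj.map ((etaleBaseChange f).map t).op := by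
        rw [h0]
    _ = _ := hκ'

end ConstantSections

/-! ### Coherence of `(g f)^* ≅ f^* g^*` with the constant-sheaf isomorphisms -/

section CompConstant

variable {Z : Scheme.{u}} (g : Y ⟶ Z) (M : Ab.{u})

set_option backward.isDefEq.respectTransparency false in
/-- On constant sections over `Z ×_Z X`, the composite
`M_X ≅ (gf)^* M_Z ≅ f^* g^* M_Z ≅ f^* M_Y ≅ M_X` is the identity. [folklore] -/
theorem constantSection_comp_constantSheafIso_coherence :
    constantSection X.smallEtaleTopology M ((etaleBaseChange (f ≫ g)).obj (Scheme.Etale.mk (𝟙 Z))) ≫ ((etalePullbackConstantSheafIso (f ≫ g) M).inv).hom.app (op ((etaleBaseChange (f ≫ g)).obj (Scheme.Etale.mk (𝟙 Z)))) ≫ ((etalePullbackComp f g).inv.app ((constantSheaf Z.smallEtaleTopology Ab.{u}).obj M)).hom.app (op ((etaleBaseChange (f ≫ g)).obj (Scheme.Etale.mk (𝟙 Z)))) ≫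
      ((etalePullback f).map (etalePullbackConstantSheafIso g M).hom).hom.app (op ((etaleBaseChange (f ≫ g)).obj (Scheme.Etale.mk (𝟙 Z)))) ≫ ((etalePullbackConstantSheafIso f M).hom).hom.app (op ((etaleBaseChange (f ≫ g)).obj (Scheme.Etale.mk (𝟙 Z)))) =
    constantSection X.smallEtaleTopology M ((etaleBaseChange (f ≫ g)).obj (Scheme.Etale.mk (𝟙 Z))) := by
  have L1fg := constantSection_comp_unit_comp_constantSheafIso (f ≫ g) M (Scheme.Etale.mk (𝟙 Z))
  have hinv : ((etalePullbackConstantSheafIso (f ≫ g) M).hom).hom.app (op ((etaleBaseChange (f ≫ g)).obj (Scheme.Etale.mk (𝟙 Z)))) ≫ ((etalePullbackConstantSheafIso (f ≫ g) M).inv).hom.app (op ((etaleBaseChange (f ≫ g)).obj (Scheme.Etale.mk (𝟙 Z)))) = 𝟙 _ :=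
    Sheaf.congr_hom_app (etalePullbackConstantSheafIso (f ≫ g) M).hom_inv_id (op ((etaleBaseChange (f ≫ g)).obj (Scheme.Etale.mk (𝟙 Z))))
  have hinv' : ((etalePullbackAdjunction (f ≫ g)).unit.app ((constantSheaf Z.smallEtaleTopology Ab.{u}).obj M)).hom.app (op (Scheme.Etale.mk (𝟙 Z))) ≫ ((etalePullbackConstantSheafIso (f ≫ g) M).hom).hom.app (op ((etaleBaseChange (f ≫ g)).obj (Scheme.Etale.mk (𝟙 Z)))) ≫ ((etalePullbackConstantSheafIso (f ≫ g) M).inv).hom.app (op ((etaleBaseChange (f ≫ g)).obj (Scheme.Etale.mk (𝟙 Z)))) = ((etalePullbackAdjunction (f ≫ g)).unit.app ((constantSheaf Z.smallEtaleTopology Ab.{u}).obj M)).hom.app (op (Scheme.Etale.mk (𝟙 Z))) := by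
    rw [hinv]; exact Category.comp_id _
  have s1 : constantSection X.smallEtaleTopology M ((etaleBaseChange (f ≫ g)).obj (Scheme.Etale.mk (𝟙 Z))) ≫ ((etalePullbackConstantSheafIso (f ≫ g) M).inv).hom.app (op ((etaleBaseChange (f ≫ g)).obj (Scheme.Etale.mk (𝟙 Z)))) = constantSection Z.smallEtaleTopology M (Scheme.Etale.mk (𝟙 Z)) ≫ ((etalePullbackAdjunction (f ≫ g)).unit.app ((constantSheaf Z.smallEtaleTopology Ab.{u}).obj M)).hom.app (op (Scheme.Etale.mk (𝟙 Z))) := by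
    rw [← L1fg]; simp only [Category.assoc]; rw [hinv']
  have s2 : ((etalePullbackAdjunction (f ≫ g)).unit.app ((constantSheaf Z.smallEtaleTopology Ab.{u}).obj M)).hom.app (op (Scheme.Etale.mk (𝟙 Z))) ≫ ((etalePullbackComp f g).inv.app ((constantSheaf Z.smallEtaleTopology Ab.{u}).obj M)).hom.app (op ((etaleBaseChange (f ≫ g)).obj (Scheme.Etale.mk (𝟙 Z)))) = ((etalePullbackAdjunction g).unit.app ((constantSheaf Z.smallEtaleTopology Ab.{u}).obj M)).hom.app (op (Scheme.Etale.mk (𝟙 Z))) ≫ ((etalePullbackAdjunction f).unit.app ((etalePullback g).obj ((constantSheaf Z.smallEtaleTopology Ab.{u}).obj M))).hom.app (op ((etaleBaseChange g).obj (Scheme.Etale.mk (𝟙 Z)))) ≫ ((etalePullback f).obj ((etalePullback g).obj ((constantSheaf Z.smallEtaleTopology Ab.{u}).obj M))).obj.map ((etaleBaseChangeComp f g).hom.app (Scheme.Etale.mk (𝟙 Z))).op :=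
    unit_app_comp_etalePullbackComp_inv_app f g ((constantSheaf Z.smallEtaleTopology Ab.{u}).obj M) (Scheme.Etale.mk (𝟙 Z))
  have s3 : ((etalePullback f).obj ((etalePullback g).obj ((constantSheaf Z.smallEtaleTopology Ab.{u}).obj M))).obj.map ((etaleBaseChangeComp f g).hom.app (Scheme.Etale.mk (𝟙 Z))).op ≫ ((etalePullback f).map (etalePullbackConstantSheafIso g M).hom).hom.app (op ((etaleBaseChange (f ≫ g)).obj (Scheme.Etale.mk (𝟙 Z)))) = ((etalePullback f).map (etalePullbackConstantSheafIso g M).hom).hom.app (op ((etaleBaseChange f).obj ((etaleBaseChange g).obj (Scheme.Etale.mk (𝟙 Z))))) ≫ ((etalePullback f).obj ((constantSheaf Y.smallEtaleTopology Ab.{u}).obj M)).obj.map ((etaleBaseChangeComp f g).hom.app (Scheme.Etale.mk (𝟙 Z))).op :=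
    ((etalePullback f).map (etalePullbackConstantSheafIso g M).hom).hom.naturality ((etaleBaseChangeComp f g).hom.app (Scheme.Etale.mk (𝟙 Z))).op
  have s4 : ((etalePullbackAdjunction f).unit.app ((etalePullback g).obj ((constantSheaf Z.smallEtaleTopology Ab.{u}).obj M))).hom.app (op ((etaleBaseChange g).obj (Scheme.Etale.mk (𝟙 Z)))) ≫ ((etalePullback f).map (etalePullbackConstantSheafIso g M).hom).hom.app (op ((etaleBaseChange f).obj ((etaleBaseChange g).obj (Scheme.Etale.mk (𝟙 Z))))) = ((etalePullbackConstantSheafIso g M).hom).hom.app (op ((etaleBaseChange g).obj (Scheme.Etale.mk (𝟙 Z)))) ≫ ((etalePullbackAdjunction f).unit.app ((constantSheaf Y.smallEtaleTopology Ab.{u}).obj M)).hom.app (op ((etaleBaseChange g).obj (Scheme.Etale.mk (𝟙 Z)))) :=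
    (Sheaf.congr_hom_app ((etalePullbackAdjunction f).unit.naturality
      (etalePullbackConstantSheafIso g M).hom) (op ((etaleBaseChange g).obj (Scheme.Etale.mk (𝟙 Z))))).symm
  have s5 : constantSection Z.smallEtaleTopology M (Scheme.Etale.mk (𝟙 Z)) ≫ ((etalePullbackAdjunction g).unit.app ((constantSheaf Z.smallEtaleTopology Ab.{u}).obj M)).hom.app (op (Scheme.Etale.mk (𝟙 Z))) ≫ ((etalePullbackConstantSheafIso g M).hom).hom.app (op ((etaleBaseChange g).obj (Scheme.Etale.mk (𝟙 Z)))) = constantSection Y.smallEtaleTopology M ((etaleBaseChange g).obj (Scheme.Etale.mk (𝟙 Z))) :=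
    constantSection_comp_unit_comp_constantSheafIso g M (Scheme.Etale.mk (𝟙 Z))
  have s6 : ((etalePullback f).obj ((constantSheaf Y.smallEtaleTopology Ab.{u}).obj M)).obj.map ((etaleBaseChangeComp f g).hom.app (Scheme.Etale.mk (𝟙 Z))).op ≫ ((etalePullbackConstantSheafIso f M).hom).hom.app (op ((etaleBaseChange (f ≫ g)).obj (Scheme.Etale.mk (𝟙 Z)))) = ((etalePullbackConstantSheafIso f M).hom).hom.app (op ((etaleBaseChange f).obj ((etaleBaseChange g).obj (Scheme.Etale.mk (𝟙 Z))))) ≫ ((constantSheaf X.smallEtaleTopology Ab.{u}).obj M).obj.map ((etaleBaseChangeComp f g).hom.app (Scheme.Etale.mk (𝟙 Z))).op :=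
    ((etalePullbackConstantSheafIso f M).hom).hom.naturality ((etaleBaseChangeComp f g).hom.app (Scheme.Etale.mk (𝟙 Z))).op
  have s7 : constantSection Y.smallEtaleTopology M ((etaleBaseChange g).obj (Scheme.Etale.mk (𝟙 Z))) ≫ ((etalePullbackAdjunction f).unit.app ((constantSheaf Y.smallEtaleTopology Ab.{u}).obj M)).hom.app (op ((etaleBaseChange g).obj (Scheme.Etale.mk (𝟙 Z)))) ≫ ((etalePullbackConstantSheafIso f M).hom).hom.app (op ((etaleBaseChange f).obj ((etaleBaseChange g).obj (Scheme.Etale.mk (𝟙 Z))))) = constantSection X.smallEtaleTopology M ((etaleBaseChange f).obj ((etaleBaseChange g).obj (Scheme.Etale.mk (𝟙 Z)))) :=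
    constantSection_comp_unit_comp_constantSheafIso f M ((etaleBaseChange g).obj (Scheme.Etale.mk (𝟙 Z)))
  have s8 : constantSection X.smallEtaleTopology M ((etaleBaseChange f).obj ((etaleBaseChange g).obj (Scheme.Etale.mk (𝟙 Z)))) ≫ ((constantSheaf X.smallEtaleTopology Ab.{u}).obj M).obj.map ((etaleBaseChangeComp f g).hom.app (Scheme.Etale.mk (𝟙 Z))).op = constantSection X.smallEtaleTopology M ((etaleBaseChange (f ≫ g)).obj (Scheme.Etale.mk (𝟙 Z))) :=
    constantSection_comp_map X.smallEtaleTopology M ((etaleBaseChangeComp f g).hom.app (Scheme.Etale.mk (𝟙 Z)))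
  calc constantSection X.smallEtaleTopology M ((etaleBaseChange (f ≫ g)).obj (Scheme.Etale.mk (𝟙 Z))) ≫ ((etalePullbackConstantSheafIso (f ≫ g) M).inv).hom.app (op ((etaleBaseChange (f ≫ g)).obj (Scheme.Etale.mk (𝟙 Z)))) ≫ ((etalePullbackComp f g).inv.app ((constantSheaf Z.smallEtaleTopology Ab.{u}).obj M)).hom.app (op ((etaleBaseChange (f ≫ g)).obj (Scheme.Etale.mk (𝟙 Z)))) ≫ ((etalePullback f).map (etalePullbackConstantSheafIso g M).hom).hom.app (op ((etaleBaseChange (f ≫ g)).obj (Scheme.Etale.mk (𝟙 Z)))) ≫ ((etalePullbackConstantSheafIso f M).hom).hom.app (op ((etaleBaseChange (f ≫ g)).obj (Scheme.Etale.mk (𝟙 Z))))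
      = (constantSection X.smallEtaleTopology M ((etaleBaseChange (f ≫ g)).obj (Scheme.Etale.mk (𝟙 Z))) ≫ ((etalePullbackConstantSheafIso (f ≫ g) M).inv).hom.app (op ((etaleBaseChange (f ≫ g)).obj (Scheme.Etale.mk (𝟙 Z))))) ≫ ((etalePullbackComp f g).inv.app ((constantSheaf Z.smallEtaleTopology Ab.{u}).obj M)).hom.app (op ((etaleBaseChange (f ≫ g)).obj (Scheme.Etale.mk (𝟙 Z)))) ≫ ((etalePullback f).map (etalePullbackConstantSheafIso g M).hom).hom.app (op ((etaleBaseChange (f ≫ g)).obj (Scheme.Etale.mk (𝟙 Z)))) ≫ ((etalePullbackConstantSheafIso f M).hom).hom.app (op ((etaleBaseChange (f ≫ g)).obj (Scheme.Etale.mk (𝟙 Z)))) := by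
        simp only [Category.assoc]
    _ = (constantSection Z.smallEtaleTopology M (Scheme.Etale.mk (𝟙 Z)) ≫ ((etalePullbackAdjunction (f ≫ g)).unit.app ((constantSheaf Z.smallEtaleTopology Ab.{u}).obj M)).hom.app (op (Scheme.Etale.mk (𝟙 Z)))) ≫ ((etalePullbackComp f g).inv.app ((constantSheaf Z.smallEtaleTopology Ab.{u}).obj M)).hom.app (op ((etaleBaseChange (f ≫ g)).obj (Scheme.Etale.mk (𝟙 Z)))) ≫ ((etalePullback f).map (etalePullbackConstantSheafIso g M).hom).hom.app (op ((etaleBaseChange (f ≫ g)).obj (Scheme.Etale.mk (𝟙 Z)))) ≫ ((etalePullbackConstantSheafIso f M).hom).hom.app (op ((etaleBaseChange (f ≫ g)).obj (Scheme.Etale.mk (𝟙 Z)))) := by rw [s1]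
    _ = constantSection Z.smallEtaleTopology M (Scheme.Etale.mk (𝟙 Z)) ≫ (((etalePullbackAdjunction (f ≫ g)).unit.app ((constantSheaf Z.smallEtaleTopology Ab.{u}).obj M)).hom.app (op (Scheme.Etale.mk (𝟙 Z))) ≫ ((etalePullbackComp f g).inv.app ((constantSheaf Z.smallEtaleTopology Ab.{u}).obj M)).hom.app (op ((etaleBaseChange (f ≫ g)).obj (Scheme.Etale.mk (𝟙 Z))))) ≫ ((etalePullback f).map (etalePullbackConstantSheafIso g M).hom).hom.app (op ((etaleBaseChange (f ≫ g)).obj (Scheme.Etale.mk (𝟙 Z)))) ≫ ((etalePullbackConstantSheafIso f M).hom).hom.app (op ((etaleBaseChange (f ≫ g)).obj (Scheme.Etale.mk (𝟙 Z)))) := by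
        simp only [Category.assoc]
    _ = constantSection Z.smallEtaleTopology M (Scheme.Etale.mk (𝟙 Z)) ≫ (((etalePullbackAdjunction g).unit.app ((constantSheaf Z.smallEtaleTopology Ab.{u}).obj M)).hom.app (op (Scheme.Etale.mk (𝟙 Z))) ≫ ((etalePullbackAdjunction f).unit.app ((etalePullback g).obj ((constantSheaf Z.smallEtaleTopology Ab.{u}).obj M))).hom.app (op ((etaleBaseChange g).obj (Scheme.Etale.mk (𝟙 Z)))) ≫ ((etalePullback f).obj ((etalePullback g).obj ((constantSheaf Z.smallEtaleTopology Ab.{u}).obj M))).obj.map ((etaleBaseChangeComp f g).hom.app (Scheme.Etale.mk (𝟙 Z))).op) ≫ ((etalePullback f).map (etalePullbackConstantSheafIso g M).hom).hom.app (op ((etaleBaseChange (f ≫ g)).obj (Scheme.Etale.mk (𝟙 Z)))) ≫ ((etalePullbackConstantSheafIso f M).hom).hom.app (op ((etaleBaseChange (f ≫ g)).obj (Scheme.Etale.mk (𝟙 Z)))) := by rw [s2]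
    _ = constantSection Z.smallEtaleTopology M (Scheme.Etale.mk (𝟙 Z)) ≫ ((etalePullbackAdjunction g).unit.app ((constantSheaf Z.smallEtaleTopology Ab.{u}).obj M)).hom.app (op (Scheme.Etale.mk (𝟙 Z))) ≫ ((etalePullbackAdjunction f).unit.app ((etalePullback g).obj ((constantSheaf Z.smallEtaleTopology Ab.{u}).obj M))).hom.app (op ((etaleBaseChange g).obj (Scheme.Etale.mk (𝟙 Z)))) ≫ (((etalePullback f).obj ((etalePullback g).obj ((constantSheaf Z.smallEtaleTopology Ab.{u}).obj M))).obj.map ((etaleBaseChangeComp f g).hom.app (Scheme.Etale.mk (𝟙 Z))).op ≫ ((etalePullback f).map (etalePullbackConstantSheafIso g M).hom).hom.app (op ((etaleBaseChange (f ≫ g)).obj (Scheme.Etale.mk (𝟙 Z))))) ≫ ((etalePullbackConstantSheafIso f M).hom).hom.app (op ((etaleBaseChange (f ≫ g)).obj (Scheme.Etale.mk (𝟙 Z)))) := by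
        simp only [Category.assoc]
    _ = constantSection Z.smallEtaleTopology M (Scheme.Etale.mk (𝟙 Z)) ≫ ((etalePullbackAdjunction g).unit.app ((constantSheaf Z.smallEtaleTopology Ab.{u}).obj M)).hom.app (op (Scheme.Etale.mk (𝟙 Z))) ≫ ((etalePullbackAdjunction f).unit.app ((etalePullback g).obj ((constantSheaf Z.smallEtaleTopology Ab.{u}).obj M))).hom.app (op ((etaleBaseChange g).obj (Scheme.Etale.mk (𝟙 Z)))) ≫ (((etalePullback f).map (etalePullbackConstantSheafIso g M).hom).hom.app (op ((etaleBaseChange f).obj ((etaleBaseChange g).obj (Scheme.Etale.mk (𝟙 Z))))) ≫ ((etalePullback f).obj ((constantSheaf Y.smallEtaleTopology Ab.{u}).obj M)).obj.map ((etaleBaseChangeComp f g).hom.app (Scheme.Etale.mk (𝟙 Z))).op) ≫ ((etalePullbackConstantSheafIso f M).hom).hom.app (op ((etaleBaseChange (f ≫ g)).obj (Scheme.Etale.mk (𝟙 Z)))) := by rw [s3]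
    _ = constantSection Z.smallEtaleTopology M (Scheme.Etale.mk (𝟙 Z)) ≫ ((etalePullbackAdjunction g).unit.app ((constantSheaf Z.smallEtaleTopology Ab.{u}).obj M)).hom.app (op (Scheme.Etale.mk (𝟙 Z))) ≫ (((etalePullbackAdjunction f).unit.app ((etalePullback g).obj ((constantSheaf Z.smallEtaleTopology Ab.{u}).obj M))).hom.app (op ((etaleBaseChange g).obj (Scheme.Etale.mk (𝟙 Z)))) ≫ ((etalePullback f).map (etalePullbackConstantSheafIso g M).hom).hom.app (op ((etaleBaseChange f).obj ((etaleBaseChange g).obj (Scheme.Etale.mk (𝟙 Z)))))) ≫ ((etalePullback f).obj ((constantSheaf Y.smallEtaleTopology Ab.{u}).obj M)).obj.map ((etaleBaseChangeComp f g).hom.app (Scheme.Etale.mk (𝟙 Z))).op ≫ ((etalePullbackConstantSheafIso f M).hom).hom.app (op ((etaleBaseChange (f ≫ g)).obj (Scheme.Etale.mk (𝟙 Z)))) := by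
        simp only [Category.assoc]
    _ = constantSection Z.smallEtaleTopology M (Scheme.Etale.mk (𝟙 Z)) ≫ ((etalePullbackAdjunction g).unit.app ((constantSheaf Z.smallEtaleTopology Ab.{u}).obj M)).hom.app (op (Scheme.Etale.mk (𝟙 Z))) ≫ (((etalePullbackConstantSheafIso g M).hom).hom.app (op ((etaleBaseChange g).obj (Scheme.Etale.mk (𝟙 Z)))) ≫ ((etalePullbackAdjunction f).unit.app ((constantSheaf Y.smallEtaleTopology Ab.{u}).obj M)).hom.app (op ((etaleBaseChange g).obj (Scheme.Etale.mk (𝟙 Z))))) ≫ ((etalePullback f).obj ((constantSheaf Y.smallEtaleTopology Ab.{u}).obj M)).obj.map ((etaleBaseChangeComp f g).hom.app (Scheme.Etale.mk (𝟙 Z))).op ≫ ((etalePullbackConstantSheafIso f M).hom).hom.app (op ((etaleBaseChange (f ≫ g)).obj (Scheme.Etale.mk (𝟙 Z)))) := by rw [s4]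
    _ = (constantSection Z.smallEtaleTopology M (Scheme.Etale.mk (𝟙 Z)) ≫ ((etalePullbackAdjunction g).unit.app ((constantSheaf Z.smallEtaleTopology Ab.{u}).obj M)).hom.app (op (Scheme.Etale.mk (𝟙 Z))) ≫ ((etalePullbackConstantSheafIso g M).hom).hom.app (op ((etaleBaseChange g).obj (Scheme.Etale.mk (𝟙 Z))))) ≫ ((etalePullbackAdjunction f).unit.app ((constantSheaf Y.smallEtaleTopology Ab.{u}).obj M)).hom.app (op ((etaleBaseChange g).obj (Scheme.Etale.mk (𝟙 Z)))) ≫ ((etalePullback f).obj ((constantSheaf Y.smallEtaleTopology Ab.{u}).obj M)).obj.map ((etaleBaseChangeComp f g).hom.app (Scheme.Etale.mk (𝟙 Z))).op ≫ ((etalePullbackConstantSheafIso f M).hom).hom.app (op ((etaleBaseChange (f ≫ g)).obj (Scheme.Etale.mk (𝟙 Z)))) := by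
        simp only [Category.assoc]
    _ = constantSection Y.smallEtaleTopology M ((etaleBaseChange g).obj (Scheme.Etale.mk (𝟙 Z))) ≫ ((etalePullbackAdjunction f).unit.app ((constantSheaf Y.smallEtaleTopology Ab.{u}).obj M)).hom.app (op ((etaleBaseChange g).obj (Scheme.Etale.mk (𝟙 Z)))) ≫ ((etalePullback f).obj ((constantSheaf Y.smallEtaleTopology Ab.{u}).obj M)).obj.map ((etaleBaseChangeComp f g).hom.app (Scheme.Etale.mk (𝟙 Z))).op ≫ ((etalePullbackConstantSheafIso f M).hom).hom.app (op ((etaleBaseChange (f ≫ g)).obj (Scheme.Etale.mk (𝟙 Z)))) := by rw [s5]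
    _ = constantSection Y.smallEtaleTopology M ((etaleBaseChange g).obj (Scheme.Etale.mk (𝟙 Z))) ≫ ((etalePullbackAdjunction f).unit.app ((constantSheaf Y.smallEtaleTopology Ab.{u}).obj M)).hom.app (op ((etaleBaseChange g).obj (Scheme.Etale.mk (𝟙 Z)))) ≫ (((etalePullbackConstantSheafIso f M).hom).hom.app (op ((etaleBaseChange f).obj ((etaleBaseChange g).obj (Scheme.Etale.mk (𝟙 Z))))) ≫ ((constantSheaf X.smallEtaleTopology Ab.{u}).obj M).obj.map ((etaleBaseChangeComp f g).hom.app (Scheme.Etale.mk (𝟙 Z))).op) := by rw [s6]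
    _ = (constantSection Y.smallEtaleTopology M ((etaleBaseChange g).obj (Scheme.Etale.mk (𝟙 Z))) ≫ ((etalePullbackAdjunction f).unit.app ((constantSheaf Y.smallEtaleTopology Ab.{u}).obj M)).hom.app (op ((etaleBaseChange g).obj (Scheme.Etale.mk (𝟙 Z)))) ≫ ((etalePullbackConstantSheafIso f M).hom).hom.app (op ((etaleBaseChange f).obj ((etaleBaseChange g).obj (Scheme.Etale.mk (𝟙 Z)))))) ≫ ((constantSheaf X.smallEtaleTopology Ab.{u}).obj M).obj.map ((etaleBaseChangeComp f g).hom.app (Scheme.Etale.mk (𝟙 Z))).op := by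
        simp only [Category.assoc]
    _ = constantSection X.smallEtaleTopology M ((etaleBaseChange f).obj ((etaleBaseChange g).obj (Scheme.Etale.mk (𝟙 Z)))) ≫ ((constantSheaf X.smallEtaleTopology Ab.{u}).obj M).obj.map ((etaleBaseChangeComp f g).hom.app (Scheme.Etale.mk (𝟙 Z))).op := by rw [s7]
    _ = constantSection X.smallEtaleTopology M ((etaleBaseChange (f ≫ g)).obj (Scheme.Etale.mk (𝟙 Z))) := s8

set_option backward.isDefEq.respectTransparency false in
/-- **Compatibility of `(g f)^* ≅ f^* g^*` with `π^* M ≅ M`**: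
`(gf)^* M_Z ≅ f^* g^* M_Z ≅ f^* M_Y ≅ M_X` equals `(gf)^* M_Z ≅ M_X`. [folklore] -/
theorem etalePullbackComp_inv_app_comp_constantSheafIso :
    (etalePullbackComp f g).inv.app ((constantSheaf Z.smallEtaleTopology Ab.{u}).obj M) ≫
      (etalePullback f).map (etalePullbackConstantSheafIso g M).hom ≫
        (etalePullbackConstantSheafIso f M).hom =
      (etalePullbackConstantSheafIso (f ≫ g) M).hom := by
  rw [← Iso.inv_comp_eq_id]
  apply constantSheaf_hom_ext (isTerminalEtaleBaseChangeObjMkId (f ≫ g))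
  change constantSection X.smallEtaleTopology M ((etaleBaseChange (f ≫ g)).obj (Scheme.Etale.mk (𝟙 Z))) ≫ ((etalePullbackConstantSheafIso (f ≫ g) M).inv).hom.app (op ((etaleBaseChange (f ≫ g)).obj (Scheme.Etale.mk (𝟙 Z)))) ≫ ((etalePullbackComp f g).inv.app ((constantSheaf Z.smallEtaleTopology Ab.{u}).obj M)).hom.app (op ((etaleBaseChange (f ≫ g)).obj (Scheme.Etale.mk (𝟙 Z)))) ≫
      ((etalePullback f).map (etalePullbackConstantSheafIso g M).hom).hom.app (op ((etaleBaseChange (f ≫ g)).obj (Scheme.Etale.mk (𝟙 Z)))) ≫ ((etalePullbackConstantSheafIso f M).hom).hom.app (op ((etaleBaseChange (f ≫ g)).obj (Scheme.Etale.mk (𝟙 Z)))) = constantSection X.smallEtaleTopology M ((etaleBaseChange (f ≫ g)).obj (Scheme.Etale.mk (𝟙 Z))) ≫ 𝟙 _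
  rw [Category.comp_id]
  exact constantSection_comp_constantSheafIso_coherence f g M

end CompConstant


/-! ### Functoriality of the pull-back on cohomology: composition -/

section CohomologyComp

variable {Z : Scheme.{u}} (g : Y ⟶ Z)

open Abelian

/-- The composite `f^* ∘ g^*` of inverse image functors is exact. [folklore] -/
instance preservesFiniteLimits_etalePullback_comp :
    PreservesFiniteLimits (etalePullback g ⋙ etalePullback f) :=
  comp_preservesFiniteLimits _ _

/-- The composite `f^* ∘ g^*` of inverse image functors is exact. [folklore] -/
instance preservesFiniteColimits_etalePullback_comp :
    PreservesFiniteColimits (etalePullback g ⋙ etalePullback f) :=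
  comp_preservesFiniteColimits _ _

set_option backward.isDefEq.respectTransparency false in
/-- `(ι_f)⁻¹ ≫ f^*((ι_g)⁻¹) = (ι_{gf})⁻¹ ≫ c⁻¹` on `ℤ`: the inverse form of
`etalePullbackComp_inv_app_comp_constantSheafIso`. [folklore] -/
theorem constantSheafIso_inv_comp_map_constantSheafIso_inv (M : Ab.{u}) :
    (etalePullbackConstantSheafIso f M).inv ≫
        (etalePullback f).map (etalePullbackConstantSheafIso g M).inv =
      (etalePullbackConstantSheafIso (f ≫ g) M).inv ≫
        (etalePullbackComp f g).inv.app ((constantSheaf Z.smallEtaleTopology Ab.{u}).obj M) := by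
  have K := etalePullbackComp_inv_app_comp_constantSheafIso f g M
  rw [Iso.eq_inv_comp, ← K]
  simp only [Category.assoc, Iso.hom_inv_id_assoc]
  exact (congrArg ((etalePullbackComp f g).inv.app _ ≫ ·)
    ((etalePullbackConstantSheafIso g M).map_hom_inv_id (etalePullback f))).trans
      (Category.comp_id _)

set_option backward.isDefEq.respectTransparency false in
/-- **Transitivity of the pull-back on étale cohomology** (Milne III Rem. 1.6 (c) with II Rem.
3.1 (f)): for `X → Y → Z` and a sheaf `F` on `Z_et`, `f^*(g^*(x)) = (gf)^*(x)` in
`Hⁿ(X_et, f^* g^* F)`, after identifying `(gf)^* F ≅ f^* g^* F` by `etalePullbackComp`. Both sides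
are `δ`-morphisms out of `Hⁿ(Z_et, –)` agreeing in degree `0` (`ext_deltaMorphism`).
[cite: Milne2025, III Remark 1.6 (c)] -/
theorem etaleCohomologyPullback_etaleCohomologyPullback (F : Sheaf Z.smallEtaleTopology Ab.{u})
    (n : ℕ) (x : F.H n) :
    etaleCohomologyPullback f _ n (etaleCohomologyPullback g F n x) =
      Sheaf.H.map ((etalePullbackComp f g).inv.app F) n
        (etaleCohomologyPullback (f ≫ g) F n x) := by
  have key := ext_deltaMorphism (etalePullback g ⋙ etalePullback f)
    (A := (constantSheaf Z.smallEtaleTopology Ab.{u}).obj (AddCommGrpCat.of (ULift.{u} ℤ)))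
    (B := (constantSheaf X.smallEtaleTopology Ab.{u}).obj (AddCommGrpCat.of (ULift.{u} ℤ)))
    (fun F n x => etaleCohomologyPullback f _ n (etaleCohomologyPullback g F n x))
    (fun F n x => Sheaf.H.map ((etalePullbackComp f g).inv.app F) n
      (etaleCohomologyPullback (f ≫ g) F n x)) ?_ ?_ ?_
  · exact congrFun (congrFun (congrFun key F) n) x
  · intro S hS n x
    change etaleCohomologyPullback f _ (n + 1)
        (etaleCohomologyPullback g _ (n + 1) (x.comp hS.extClass rfl)) = _
    rw [etaleCohomologyPullback_comp_extClass]
    exact (etaleCohomologyPullback_comp_extClass f (hS.map_of_exact (etalePullback g)) n _).trans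
      rfl
  · intro S hS n x
    change Sheaf.H.map ((etalePullbackComp f g).inv.app S.X₁) (n + 1)
        (etaleCohomologyPullback (f ≫ g) _ (n + 1) (x.comp hS.extClass rfl)) =
      (Sheaf.H.map ((etalePullbackComp f g).inv.app S.X₃) n
        (etaleCohomologyPullback (f ≫ g) _ n x)).comp
          (hS.map_of_exact (etalePullback g ⋙ etalePullback f)).extClass rfl
    have nat : (hS.map_of_exact (etalePullback (f ≫ g))).extClass.comp
        (Ext.mk₀ ((etalePullbackComp f g).inv.app S.X₁)) (add_zero 1) =
        (Ext.mk₀ ((etalePullbackComp f g).inv.app S.X₃)).comp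
          (hS.map_of_exact (etalePullback g ⋙ etalePullback f)).extClass (zero_add 1) :=
      (hS.map_of_exact (etalePullback (f ≫ g))).extClass_naturality
        (hS.map_of_exact (etalePullback g ⋙ etalePullback f))
        (S.mapNatTrans (etalePullbackComp f g).inv)
    rw [etaleCohomologyPullback_comp_extClass, Sheaf.H.map_apply, Sheaf.H.map_apply,
      Ext.comp_assoc_of_third_deg_zero, nat, Ext.comp_assoc_of_second_deg_zero]
  · intro F x
    obtain ⟨x₀, rfl⟩ := (Ext.mk₀_bijective _ _).2 x
    change etaleCohomologyPullback f _ 0 (etaleCohomologyPullback g F 0 (Ext.mk₀ x₀)) =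
      Sheaf.H.map ((etalePullbackComp f g).inv.app F) 0
        (etaleCohomologyPullback (f ≫ g) F 0 (Ext.mk₀ x₀))
    simp only [etaleCohomologyPullback_apply, Ext.mapExactFunctor_mk₀, Ext.mk₀_comp_mk₀,
      Sheaf.H.map_apply, Functor.map_comp, Category.assoc]
    rw [(etalePullbackComp f g).inv.naturality x₀,
      reassoc_of% (constantSheafIso_inv_comp_map_constantSheafIso_inv f g
        (AddCommGrpCat.of (ULift.{u} ℤ)))]
    rfl

set_option backward.isDefEq.respectTransparency false in
/-- **Functoriality of `f^* : Hⁿ(Y_et, M) → Hⁿ(X_et, M)`: `(g ∘ f)^* = f^* ∘ g^*`** (Milne III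
Rem. 1.6 (c): "`Hⁱ(X_E, F)` is a contravariant functor"; II Rem. 3.1 (f)).
[cite: Milne2025, III Remark 1.6 (c)] -/
theorem etaleCohomologyMap_comp (M : Ab.{u}) (n : ℕ)
    (x : ((constantSheaf Z.smallEtaleTopology Ab.{u}).obj M).H n) :
    etaleCohomologyMap (f ≫ g) M n x = etaleCohomologyMap f M n (etaleCohomologyMap g M n x) := by
  symm
  calc etaleCohomologyMap f M n (etaleCohomologyMap g M n x)
      = Sheaf.H.map (etalePullbackConstantSheafIso f M).hom n (etaleCohomologyPullback f _ n
          (Sheaf.H.map (etalePullbackConstantSheafIso g M).hom n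
            (etaleCohomologyPullback g _ n x))) := rfl
    _ = Sheaf.H.map (etalePullbackConstantSheafIso f M).hom n
          (Sheaf.H.map ((etalePullback f).map (etalePullbackConstantSheafIso g M).hom) n
            (etaleCohomologyPullback f _ n (etaleCohomologyPullback g _ n x))) := by
        rw [etaleCohomologyPullback_map]
    _ = Sheaf.H.map (etalePullbackConstantSheafIso f M).hom n
          (Sheaf.H.map ((etalePullback f).map (etalePullbackConstantSheafIso g M).hom) n
            (Sheaf.H.map ((etalePullbackComp f g).inv.app _) n
              (etaleCohomologyPullback (f ≫ g) _ n x))) := by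
        rw [etaleCohomologyPullback_etaleCohomologyPullback]
    _ = Sheaf.H.map ((etalePullbackComp f g).inv.app ((constantSheaf Z.smallEtaleTopology Ab.{u}).obj M) ≫
          (etalePullback f).map (etalePullbackConstantSheafIso g M).hom ≫
            (etalePullbackConstantSheafIso f M).hom) n
          (etaleCohomologyPullback (f ≫ g) _ n x) := by
        rw [Sheaf.H.map_comp_apply, Sheaf.H.map_comp_apply]; exact rfl
    _ = Sheaf.H.map (etalePullbackConstantSheafIso (f ≫ g) M).hom n
          (etaleCohomologyPullback (f ≫ g) _ n x) := by
        rw [etalePullbackComp_inv_app_comp_constantSheafIso]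
    _ = etaleCohomologyMap (f ≫ g) M n x := rfl

end CohomologyComp


/-! ### Identity: `(𝟙_X)^* ≅ 𝟭` -/

section Id

variable (X)

set_option backward.isDefEq.respectTransparency false in
/-- Base change along the identity is the identity: `U ×_X X ≅ U` (first projection). [folklore] -/
noncomputable def etaleBaseChangeId : etaleBaseChange (𝟙 X) ≅ 𝟭 X.Etale :=
  NatIso.ofComponents
    (fun U => MorphismProperty.Over.isoMk (asIso (pullback.fst U.hom (𝟙 X)))
      (by simp [pullback.condition]))
    (fun {U V} g => by
      apply MorphismProperty.Over.Hom.ext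
      rw [MorphismProperty.Comma.comp_left, MorphismProperty.Comma.comp_left]
      simp [MorphismProperty.Over.pullback_map_left])

/-- **`(𝟙_X)_* = 𝟭`** (the case `π = 𝟙` of Milne II Rem. 3.1 (f)), induced by `etaleBaseChangeId`.
[folklore] -/
noncomputable def etalePushforwardId : etalePushforward (𝟙 X) Ab.{u} ≅ 𝟭 _ :=
  Functor.sheafPushforwardContinuousId' (etaleBaseChangeId X) Ab.{u} X.smallEtaleTopology

/-- Components of `etalePushforwardId`: `P(U) → ((𝟙_X)_* P)(U) = P(U ×_X X)` is restriction along
`U ×_X X ≅ U`. [folklore] -/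
theorem etalePushforwardId_inv_app_hom_app (P : Sheaf X.smallEtaleTopology Ab.{u}) (U : X.Etale) :
    ((etalePushforwardId X).inv.app P).hom.app (op U) =
      P.obj.map ((etaleBaseChangeId X).hom.app U).op := by
  simp [etalePushforwardId, Functor.sheafPushforwardContinuousId',
    Functor.sheafPushforwardContinuousId, Functor.sheafPushforwardContinuousIso]
  exact Category.id_comp _

/-- **`(𝟙_X)^* ≅ 𝟭`**: the isomorphism of left adjoints conjugate to `etalePushforwardId`
(Mathlib `Adjunction.leftAdjointIdIso`). [folklore] -/
noncomputable def etalePullbackId : etalePullback (𝟙 X) ≅ 𝟭 _ :=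
  (etalePullbackAdjunction (𝟙 X)).leftAdjointIdIso (etalePushforwardId X)

/-- `etalePullbackId` is conjugate to `etalePushforwardId`. [folklore] -/
theorem conjugateEquiv_etalePullbackId_hom :
    conjugateEquiv .id (etalePullbackAdjunction (𝟙 X)) (etalePullbackId X).hom =
      (etalePushforwardId X).inv :=
  Adjunction.conjugateEquiv_leftAdjointIdIso_hom _ _

set_option backward.isDefEq.respectTransparency false in
/-- The unit relation defining `etalePullbackId`: `η_𝟙(U) ≫ u_P(U ×_X X) = (restriction along
U ×_X X ≅ U)`. [folklore] -/
theorem unit_app_comp_etalePullbackId_hom_app (P : Sheaf X.smallEtaleTopology Ab.{u})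
    (U : X.Etale) :
    ((etalePullbackAdjunction (𝟙 X)).unit.app P).hom.app (op (U)) ≫ ((etalePullbackId X).hom.app P).hom.app (op ((etaleBaseChange (𝟙 X)).obj U)) =
      P.obj.map ((etaleBaseChangeId X).hom.app U).op := by
  have h := unit_conjugateEquiv Adjunction.id (etalePullbackAdjunction (𝟙 X))
    (etalePullbackId X).hom P
  rw [conjugateEquiv_etalePullbackId_hom] at h
  have h' := Sheaf.congr_hom_app h (op U)
  have e1 : (((Adjunction.id (C := Sheaf X.smallEtaleTopology Ab.{u})).unit.app P) ≫
      (etalePushforwardId X).inv.app P).hom.app (op U) =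
      P.obj.map ((etaleBaseChangeId X).hom.app U).op := by
    rw [← etalePushforwardId_inv_app_hom_app]
    exact Category.id_comp _
  exact h'.symm.trans e1

variable (M : Ab.{u})

set_option backward.isDefEq.respectTransparency false in
/-- **Compatibility of `(𝟙_X)^* ≅ 𝟭` with `π^* M ≅ M`**: on `M_X` the two isomorphisms
`(𝟙_X)^* M_X ≅ M_X` agree. [folklore] -/
theorem etalePullbackId_hom_app_constantSheaf :
    (etalePullbackId X).hom.app ((constantSheaf X.smallEtaleTopology Ab.{u}).obj M) = (etalePullbackConstantSheafIso (𝟙 X) M).hom := by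
  rw [← Iso.inv_comp_eq_id]
  apply constantSheaf_hom_ext (isTerminalEtaleBaseChangeObjMkId (𝟙 X))
  change constantSection X.smallEtaleTopology M ((etaleBaseChange (𝟙 X)).obj (Scheme.Etale.mk (𝟙 X))) ≫ ((etalePullbackConstantSheafIso (𝟙 X) M).inv).hom.app (op ((etaleBaseChange (𝟙 X)).obj (Scheme.Etale.mk (𝟙 X)))) ≫ ((etalePullbackId X).hom.app ((constantSheaf X.smallEtaleTopology Ab.{u}).obj M)).hom.app (op ((etaleBaseChange (𝟙 X)).obj (Scheme.Etale.mk (𝟙 X)))) = constantSection X.smallEtaleTopology M ((etaleBaseChange (𝟙 X)).obj (Scheme.Etale.mk (𝟙 X))) ≫ 𝟙 _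
  rw [Category.comp_id]
  have L1 := constantSection_comp_unit_comp_constantSheafIso (𝟙 X) M (Scheme.Etale.mk (𝟙 X))
  have hinv : ((etalePullbackConstantSheafIso (𝟙 X) M).hom).hom.app (op ((etaleBaseChange (𝟙 X)).obj (Scheme.Etale.mk (𝟙 X)))) ≫ ((etalePullbackConstantSheafIso (𝟙 X) M).inv).hom.app (op ((etaleBaseChange (𝟙 X)).obj (Scheme.Etale.mk (𝟙 X)))) = 𝟙 _ :=
    Sheaf.congr_hom_app (etalePullbackConstantSheafIso (𝟙 X) M).hom_inv_id (op ((etaleBaseChange (𝟙 X)).obj (Scheme.Etale.mk (𝟙 X))))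
  have hinv' : ((etalePullbackAdjunction (𝟙 X)).unit.app ((constantSheaf X.smallEtaleTopology Ab.{u}).obj M)).hom.app (op (Scheme.Etale.mk (𝟙 X))) ≫ ((etalePullbackConstantSheafIso (𝟙 X) M).hom).hom.app (op ((etaleBaseChange (𝟙 X)).obj (Scheme.Etale.mk (𝟙 X)))) ≫ ((etalePullbackConstantSheafIso (𝟙 X) M).inv).hom.app (op ((etaleBaseChange (𝟙 X)).obj (Scheme.Etale.mk (𝟙 X)))) = ((etalePullbackAdjunction (𝟙 X)).unit.app ((constantSheaf X.smallEtaleTopology Ab.{u}).obj M)).hom.app (op (Scheme.Etale.mk (𝟙 X))) := by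
    rw [hinv]; exact Category.comp_id _
  have s1 : constantSection X.smallEtaleTopology M ((etaleBaseChange (𝟙 X)).obj (Scheme.Etale.mk (𝟙 X))) ≫ ((etalePullbackConstantSheafIso (𝟙 X) M).inv).hom.app (op ((etaleBaseChange (𝟙 X)).obj (Scheme.Etale.mk (𝟙 X)))) = constantSection X.smallEtaleTopology M (Scheme.Etale.mk (𝟙 X)) ≫ ((etalePullbackAdjunction (𝟙 X)).unit.app ((constantSheaf X.smallEtaleTopology Ab.{u}).obj M)).hom.app (op (Scheme.Etale.mk (𝟙 X))) := by
    rw [← L1]; simp only [Category.assoc]; rw [hinv']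
  have s2 : ((etalePullbackAdjunction (𝟙 X)).unit.app ((constantSheaf X.smallEtaleTopology Ab.{u}).obj M)).hom.app (op (Scheme.Etale.mk (𝟙 X))) ≫ ((etalePullbackId X).hom.app ((constantSheaf X.smallEtaleTopology Ab.{u}).obj M)).hom.app (op ((etaleBaseChange (𝟙 X)).obj (Scheme.Etale.mk (𝟙 X)))) = ((constantSheaf X.smallEtaleTopology Ab.{u}).obj M).obj.map ((etaleBaseChangeId X).hom.app (Scheme.Etale.mk (𝟙 X))).op :=
    unit_app_comp_etalePullbackId_hom_app X ((constantSheaf X.smallEtaleTopology Ab.{u}).obj M) (Scheme.Etale.mk (𝟙 X))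
  have s3 : constantSection X.smallEtaleTopology M (Scheme.Etale.mk (𝟙 X)) ≫ ((constantSheaf X.smallEtaleTopology Ab.{u}).obj M).obj.map ((etaleBaseChangeId X).hom.app (Scheme.Etale.mk (𝟙 X))).op = constantSection X.smallEtaleTopology M ((etaleBaseChange (𝟙 X)).obj (Scheme.Etale.mk (𝟙 X))) :=
    constantSection_comp_map X.smallEtaleTopology M ((etaleBaseChangeId X).hom.app (Scheme.Etale.mk (𝟙 X)))
  calc constantSection X.smallEtaleTopology M ((etaleBaseChange (𝟙 X)).obj (Scheme.Etale.mk (𝟙 X))) ≫ ((etalePullbackConstantSheafIso (𝟙 X) M).inv).hom.app (op ((etaleBaseChange (𝟙 X)).obj (Scheme.Etale.mk (𝟙 X)))) ≫ ((etalePullbackId X).hom.app ((constantSheaf X.smallEtaleTopology Ab.{u}).obj M)).hom.app (op ((etaleBaseChange (𝟙 X)).obj (Scheme.Etale.mk (𝟙 X))))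
      = (constantSection X.smallEtaleTopology M ((etaleBaseChange (𝟙 X)).obj (Scheme.Etale.mk (𝟙 X))) ≫ ((etalePullbackConstantSheafIso (𝟙 X) M).inv).hom.app (op ((etaleBaseChange (𝟙 X)).obj (Scheme.Etale.mk (𝟙 X))))) ≫ ((etalePullbackId X).hom.app ((constantSheaf X.smallEtaleTopology Ab.{u}).obj M)).hom.app (op ((etaleBaseChange (𝟙 X)).obj (Scheme.Etale.mk (𝟙 X)))) := by simp only [Category.assoc]
    _ = (constantSection X.smallEtaleTopology M (Scheme.Etale.mk (𝟙 X)) ≫ ((etalePullbackAdjunction (𝟙 X)).unit.app ((constantSheaf X.smallEtaleTopology Ab.{u}).obj M)).hom.app (op (Scheme.Etale.mk (𝟙 X)))) ≫ ((etalePullbackId X).hom.app ((constantSheaf X.smallEtaleTopology Ab.{u}).obj M)).hom.app (op ((etaleBaseChange (𝟙 X)).obj (Scheme.Etale.mk (𝟙 X)))) := by rw [s1]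
    _ = constantSection X.smallEtaleTopology M (Scheme.Etale.mk (𝟙 X)) ≫ (((etalePullbackAdjunction (𝟙 X)).unit.app ((constantSheaf X.smallEtaleTopology Ab.{u}).obj M)).hom.app (op (Scheme.Etale.mk (𝟙 X))) ≫ ((etalePullbackId X).hom.app ((constantSheaf X.smallEtaleTopology Ab.{u}).obj M)).hom.app (op ((etaleBaseChange (𝟙 X)).obj (Scheme.Etale.mk (𝟙 X))))) := by simp only [Category.assoc]
    _ = constantSection X.smallEtaleTopology M (Scheme.Etale.mk (𝟙 X)) ≫ ((constantSheaf X.smallEtaleTopology Ab.{u}).obj M).obj.map ((etaleBaseChangeId X).hom.app (Scheme.Etale.mk (𝟙 X))).op := by rw [s2]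
    _ = constantSection X.smallEtaleTopology M ((etaleBaseChange (𝟙 X)).obj (Scheme.Etale.mk (𝟙 X))) := s3

end Id

/-! ### Functoriality of the pull-back on cohomology: identity -/

section CohomologyId

variable (X)

open Abelian

set_option backward.isDefEq.respectTransparency false in
/-- **The pull-back along the identity is the identity** on `Hⁿ(X_et, F)`, after identifying
`(𝟙_X)^* F ≅ F` by `etalePullbackId` (both sides are `δ`-morphisms out of `Hⁿ(X_et, –)` agreeing
in degree `0`). [cite: Milne2025, III Remark 1.6 (c)] -/
theorem etaleCohomologyPullback_id (F : Sheaf X.smallEtaleTopology Ab.{u}) (n : ℕ) (x : F.H n) :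
    Sheaf.H.map ((etalePullbackId X).hom.app F) n (etaleCohomologyPullback (𝟙 X) F n x) = x := by
  have key := ext_deltaMorphism (𝟭 (Sheaf X.smallEtaleTopology Ab.{u}))
    (A := (constantSheaf X.smallEtaleTopology Ab.{u}).obj (AddCommGrpCat.of (ULift.{u} ℤ)))
    (B := (constantSheaf X.smallEtaleTopology Ab.{u}).obj (AddCommGrpCat.of (ULift.{u} ℤ)))
    (fun F n x => Sheaf.H.map ((etalePullbackId X).hom.app F) n
      (etaleCohomologyPullback (𝟙 X) F n x))
    (fun F n x => x) ?_ ?_ ?_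
  · exact congrFun (congrFun (congrFun key F) n) x
  · intro S hS n x
    change Sheaf.H.map ((etalePullbackId X).hom.app S.X₁) (n + 1)
        (etaleCohomologyPullback (𝟙 X) _ (n + 1) (x.comp hS.extClass rfl)) =
      (Sheaf.H.map ((etalePullbackId X).hom.app S.X₃) n
        (etaleCohomologyPullback (𝟙 X) _ n x)).comp
          (hS.map_of_exact (𝟭 _)).extClass rfl
    have nat : (hS.map_of_exact (etalePullback (𝟙 X))).extClass.comp
        (Ext.mk₀ ((etalePullbackId X).hom.app S.X₁)) (add_zero 1) =
        (Ext.mk₀ ((etalePullbackId X).hom.app S.X₃)).comp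
          (hS.map_of_exact (𝟭 _)).extClass (zero_add 1) :=
      (hS.map_of_exact (etalePullback (𝟙 X))).extClass_naturality
        (hS.map_of_exact (𝟭 _)) (S.mapNatTrans (etalePullbackId X).hom)
    rw [etaleCohomologyPullback_comp_extClass, Sheaf.H.map_apply, Sheaf.H.map_apply,
      Ext.comp_assoc_of_third_deg_zero, nat, Ext.comp_assoc_of_second_deg_zero]
  · intro S hS n x
    rfl
  · intro F x
    obtain ⟨x₀, rfl⟩ := (Ext.mk₀_bijective _ _).2 x
    change Sheaf.H.map ((etalePullbackId X).hom.app F) 0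
        (etaleCohomologyPullback (𝟙 X) F 0 (Ext.mk₀ x₀)) = Ext.mk₀ x₀
    have K : (etalePullbackConstantSheafIso (𝟙 X) (AddCommGrpCat.of (ULift.{u} ℤ))).inv ≫
        (etalePullbackId X).hom.app _ = 𝟙 _ := by
      rw [etalePullbackId_hom_app_constantSheaf, Iso.inv_hom_id]
    simp only [etaleCohomologyPullback_apply, Ext.mapExactFunctor_mk₀, Ext.mk₀_comp_mk₀,
      Sheaf.H.map_apply, Category.assoc]
    rw [(etalePullbackId X).hom.naturality x₀, reassoc_of% K]
    rfl

/-- **Functoriality of `f^* : Hⁿ(Y_et, M) → Hⁿ(X_et, M)`: `(𝟙_X)^* = id`.**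
[cite: Milne2025, III Remark 1.6 (c)] -/
theorem etaleCohomologyMap_id (M : Ab.{u}) (n : ℕ)
    (x : ((constantSheaf X.smallEtaleTopology Ab.{u}).obj M).H n) :
    etaleCohomologyMap (𝟙 X) M n x = x := by
  rw [etaleCohomologyMap_apply, ← etalePullbackId_hom_app_constantSheaf]
  exact etaleCohomologyPullback_id X _ n x

end CohomologyId


end Literature.AlgebraicGeometry.Motives
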